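import Mathlib
import Summits.Ventures.PercRepro2.Defs
import Summits.Ventures.PercRepro2.Independence
import Summits.Ventures.PercRepro2.Harris
import Summits.Ventures.PercRepro2.ZCTwoEdge
import Summits.Ventures.PercRepro2.ZCLeafRoot
import Summits.Ventures.PercRepro2.ZCRootWCert
import Summits.Ventures.PercRepro2.ZCA3WTypes
import Summits.Ventures.PercRepro2.ZCRootWCells

/-!
# Theorem F (MINE-A.md §70.7), abstract form — (ZC) when the root `a₁` has degree two with
neighbours `a₃` and a non-mark `w`, from (ZC) on `G − a₁` for the marks `(w, a₃, o)`
(blind cell PercRepro2, mine-a g24)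

Abstract setting: two distinct edges `f₁` (weight `p f₁`), `f₂` (weight `p f₂`) and six events of the
configuration space that ignore `f₁`, `f₂` — in the graph instance (`ZCRootWGraph.lean`) they are the
events of `G − a₁`: `A = {a₃ ↔ o}`, `W = {a₃ ↔ w}`, `Γ = {w ↔ o}`, `YK = {{a₁} ∪ C(a₃) ∈ 𝒰}`,
`YW = {{a₁} ∪ C(w) ∈ 𝒰}`, `YB = {{a₁} ∪ C(a₃) ∪ C(w) ∈ 𝒰}` (`{a₁} ∉ 𝒰`).  The five types of
`(a₃, o, w)` are `T₁ = A ∩ W`, `T₂ = A ∩ Wᶜ`, `T₃ = Aᶜ ∩ W`, `T₄ = Aᶜ ∩ Wᶜ ∩ Γ`, `T₅ = Aᶜ ∩ Wᶜ ∩ Γᶜ`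
(`ZCA3WTypes`), and the four (ZC) events are `e = {f₁ open} ∪ ({f₂ open} ∩ W)`,
`L = ({f₁ open} ∩ A) ∪ ({f₂ open} ∩ Γ)`, `γ = A ∪ (e ∩ L)`,
`U = ({f₁ open, f₂ closed} ∩ YK) ∪ ({f₁ closed, f₂ open} ∩ YW) ∪ ({f₁, f₂ open} ∩ YB)`.

**Theorem** (`zc_rootw`): with `A, W, Γ, YK, YW, YB` increasing, the transitivity relations,
`YK ⊆ YB`, `YW ⊆ YB`, `YK ∩ W = YW ∩ W = YB ∩ W` (on `a₃ ↔ w` the three glued clusters coincide),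
lemma (P1) `P(T₃) P(T₂) ≤ P(T₁) P(T₅)` (middle vertex `a₃`) and the inductive hypothesis
`(ZC)(W, Γ, A; YW) ≥ 0` (= (ZC) on `G − a₁` for the marks `(w, a₃, o)` and the up-set shifted by `a₁`),
(ZC) `P(D) Cov(U, eL) − P(B) Cov(U, e¬L) ≥ 0`.  The (W1) atom of the certificate (§70.5) is supplied
by `w1_nonneg` from the inductive (ZC), Harris, Harris-mixed and (P1); the kernel certificate is
`zc_rootw_cert` (66 terms).  One seat.
-/

namespace Summit.Ventures.PercRepro2

section TheoremFAbstract

variable {E : Type*} [Fintype E] [DecidableEq E] {R : Type*} [CommRing R] [LinearOrder R]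
  [IsStrictOrderedRing R]

/-- **Theorem F, abstract form** — see the module docstring. -/
theorem zc_rootw {p : E → R} (hp : IsProbVec p) {f₁ f₂ : E} (hf : f₁ ≠ f₂)
    {A W Γ YK YW YB : Set (Config E)}
    (hA : ∀ (ω : Config E) (b₁ b₂ : Bool),
      Function.update (Function.update ω f₁ b₁) f₂ b₂ ∈ A ↔ ω ∈ A)
    (hW : ∀ (ω : Config E) (b₁ b₂ : Bool),
      Function.update (Function.update ω f₁ b₁) f₂ b₂ ∈ W ↔ ω ∈ W)
    (hΓ : ∀ (ω : Config E) (b₁ b₂ : Bool),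
      Function.update (Function.update ω f₁ b₁) f₂ b₂ ∈ Γ ↔ ω ∈ Γ)
    (hYK : ∀ (ω : Config E) (b₁ b₂ : Bool),
      Function.update (Function.update ω f₁ b₁) f₂ b₂ ∈ YK ↔ ω ∈ YK)
    (hYW : ∀ (ω : Config E) (b₁ b₂ : Bool),
      Function.update (Function.update ω f₁ b₁) f₂ b₂ ∈ YW ↔ ω ∈ YW)
    (hYB : ∀ (ω : Config E) (b₁ b₂ : Bool),
      Function.update (Function.update ω f₁ b₁) f₂ b₂ ∈ YB ↔ ω ∈ YB)
    (hAup : IsUpperSet A) (hWup : IsUpperSet W) (hΓup : IsUpperSet Γ)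
    (hYKup : IsUpperSet YK) (hYWup : IsUpperSet YW) (hYBup : IsUpperSet YB)
    (hWΓ : ∀ ω, ω ∈ W → ω ∈ Γ → ω ∈ A) (hAW : ∀ ω, ω ∈ A → ω ∈ W → ω ∈ Γ)
    (hAΓ : ∀ ω, ω ∈ A → ω ∈ Γ → ω ∈ W)
    (hKB : YK ⊆ YB) (hWB : YW ⊆ YB) (hKW : YK ∩ W = YW ∩ W) (hWBW : YW ∩ W = YB ∩ W)
    (hP1 : prob p (Aᶜ ∩ W) * prob p (A ∩ Wᶜ) ≤ prob p (A ∩ W) * prob p (Aᶜ ∩ Wᶜ ∩ Γᶜ))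
    (hZC : 0 ≤ prob p (Wᶜ ∩ Γᶜ ∩ Aᶜ) * (prob p (YW ∩ (W ∩ Γ)) - prob p YW * prob p (W ∩ Γ))
      - prob p (Wᶜ ∩ Γᶜ ∩ A) * (prob p (YW ∩ (W ∩ Γᶜ)) - prob p YW * prob p (W ∩ Γᶜ))) :
    let e := openEdge f₁ ∪ (openEdge f₂ ∩ W)
    let L := (openEdge f₁ ∩ A) ∪ (openEdge f₂ ∩ Γ)
    let U := (openEdge f₁ ∩ closedEdge f₂ ∩ YK) ∪ (closedEdge f₁ ∩ openEdge f₂ ∩ YW)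
      ∪ (openEdge f₁ ∩ openEdge f₂ ∩ YB)
    let γ := A ∪ (e ∩ L)
    0 ≤ prob p (eᶜ ∩ Lᶜ ∩ γᶜ) * (prob p (U ∩ (e ∩ L)) - prob p U * prob p (e ∩ L))
      - prob p (eᶜ ∩ Lᶜ ∩ γ) * (prob p (U ∩ (e ∩ Lᶜ)) - prob p U * prob p (e ∩ Lᶜ)) := by
  intro e L U γ
  -- the cell expansions
  have PeL := rootw_prob_eL p hf hA hW hΓ
  have PenL := rootw_prob_enL p hf hA hW hΓ
  have PUeL := rootw_prob_UeL p hf hA hW hΓ hYK hYW hYB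
  have PUenL := rootw_prob_UenL p hf hA hW hΓ hYK hYW hYB
  have PU := rootw_prob_U p hf hYK hYW hYB
  have PB := rootw_prob_B p hf hA hW hΓ
  have PD := rootw_prob_D p hf hA hW hΓ
  -- the type sets in the cells, in the canonical form
  have sWΓ : W ∩ Γ = A ∩ W := by
    ext ω; have h1 := hWΓ ω; have h2 := hAW ω
    simp only [Set.mem_inter_iff] at h1 h2 ⊢; tauto
  have sWΓc : W ∩ Γᶜ = Aᶜ ∩ W := by
    ext ω; have h1 := hWΓ ω; have h2 := hAW ω
    simp only [Set.mem_inter_iff, Set.mem_compl_iff] at h1 h2 ⊢; tauto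
  have sWcΓcA : Wᶜ ∩ Γᶜ ∩ A = A ∩ Wᶜ := by
    ext ω; have h1 := hAΓ ω
    simp only [Set.mem_inter_iff, Set.mem_compl_iff] at h1 ⊢; tauto
  have sWcΓcAc : Wᶜ ∩ Γᶜ ∩ Aᶜ = Aᶜ ∩ Wᶜ ∩ Γᶜ := by
    ext ω; simp only [Set.mem_inter_iff, Set.mem_compl_iff]; tauto
  rw [sWΓ] at PeL PUeL
  rw [sWΓc] at PenL PUenL
  rw [sWcΓcA] at PB
  rw [sWcΓcAc] at PD
  rw [sWΓ, sWΓc, sWcΓcA, sWcΓcAc] at hZC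
  -- the coincidences on `W`: `YK ∩ T = YW ∩ T = YB ∩ T` for `T ⊆ W`
  have coin : ∀ {X Y : Set (Config E)}, X ∩ W = Y ∩ W → ∀ S : Set (Config E),
      prob p (Y ∩ (S ∩ W)) = prob p (X ∩ (S ∩ W)) := by
    intro X Y h S
    rw [← Set.inter_assoc, ← Set.inter_assoc, Set.inter_comm Y S, Set.inter_comm X S,
      Set.inter_assoc, Set.inter_assoc, h]
  have cW1 := coin hKW A
  have cW3 := coin hKW Aᶜ
  have cB1 := coin hWBW A
  have cB3 := coin hWBW Aᶜ
  rw [cW1] at cB1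
  rw [cW3] at cB3
  -- type probabilities
  have hsum := prob_eq_sum_five p A W Γ Set.univ
  simp only [Set.univ_inter, prob_univ] at hsum
  have PAΓ := prob_inter_union_AΓ p hWΓ Set.univ
  have PA := prob_inter_A p (A := A) (W := W) Set.univ
  have PAΓc := prob_inter_compl_union_AΓ p hWΓ Set.univ
  have PAc := prob_inter_Ac p (A := A) (W := W) (Γ := Γ) Set.univ
  simp only [Set.univ_inter] at PAΓ PA PAΓc PAc
  -- masses
  have MYBAΓ := prob_inter_union_AΓ p hWΓ YB
  rw [cB1] at MYBAΓ
  have MYKA := prob_inter_A p (A := A) (W := W) YK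
  have MYBAΓc := prob_inter_compl_union_AΓ p hWΓ YB
  rw [cB3] at MYBAΓc
  have MYKAc := prob_inter_Ac p (A := A) (W := W) (Γ := Γ) YK
  have MYB := prob_eq_sum_five p A W Γ YB
  rw [cB1, cB3] at MYB
  have MYK := prob_eq_sum_five p A W Γ YK
  have MYW := prob_eq_sum_five p A W Γ YW
  rw [cW1, cW3] at MYW
  have MYWAΓc := prob_inter_compl_union_AΓ p hWΓ YW
  rw [cW3] at MYWAΓc
  have MYKAΓ := prob_inter_union_AΓ p hWΓ YK
  -- Harris slacks (with `P(S) P(X)` in the certificate's order)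
  have hT1up : IsUpperSet (A ∩ W) := hAup.inter hWup
  have hAΓup : IsUpperSet (A ∪ Γ) := hAup.union hΓup
  have har : ∀ {X S : Set (Config E)}, IsUpperSet X → IsUpperSet S →
      0 ≤ prob p (X ∩ S) - prob p S * prob p X := fun hX hS => by
    rw [mul_comm]; exact sub_nonneg.2 (prob_mul_prob_le_prob_inter hp hX hS)
  have hHarB_12 := har hYBup hAup
  have hHarB_124 := har hYBup hAΓup
  have hHarK_12 := har hYKup hAup
  have hHarK_124 := har hYKup hAΓup
  have hHarW_1 := har hYWup hT1up
  rw [MYB] at hHarB_12 hHarB_124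
  rw [prob_inter_A p (A := A) (W := W) YB, cB1, PA] at hHarB_12
  rw [MYBAΓ, PAΓ] at hHarB_124
  rw [MYK] at hHarK_12 hHarK_124
  rw [MYKA, PA] at hHarK_12
  rw [MYKAΓ, PAΓ] at hHarK_124
  rw [MYW, cW1] at hHarW_1
  -- Harris-mixed: `YW` against the decreasing `(A ∪ Γ)ᶜ`
  have hmix : prob p (YW ∩ (A ∪ Γ)ᶜ) ≤ prob p YW * prob p (A ∪ Γ)ᶜ := by
    have h := prob_inter_le_prob_mul_prob_of_isLowerSet hp hAΓup.compl hYWup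
    rw [Set.inter_comm, mul_comm] at h
    exact h
  rw [MYWAΓc, MYW, PAΓc] at hmix
  -- monotonicity slacks
  have mono : ∀ {X Y : Set (Config E)} (T : Set (Config E)), X ⊆ Y →
      0 ≤ prob p (Y ∩ T) - prob p (X ∩ T) :=
    fun T h => sub_nonneg.2 (prob_mono hp (Set.inter_subset_inter_left _ h))
  have hy2B_y2K := mono (A ∩ Wᶜ) hKB
  have hy2B_y2W := mono (A ∩ Wᶜ) hWB
  have hy4B_y4K := mono (Aᶜ ∩ Wᶜ ∩ Γ) hKB
  have hy4B_y4W := mono (Aᶜ ∩ Wᶜ ∩ Γ) hWB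
  have hy5B_y5W := mono (Aᶜ ∩ Wᶜ ∩ Γᶜ) hWB
  -- the inductive atom and (W1) in the certificate's shape
  rw [cW1, cW3, MYW] at hZC
  have hp0 := hp.nonneg f₁
  have hp1 : 0 ≤ 1 - p f₁ := sub_nonneg.2 (hp.le_one f₁)
  have hq0 := hp.nonneg f₂
  have hq1 : 0 ≤ 1 - p f₂ := sub_nonneg.2 (hp.le_one f₂)
  have hT1 : 0 ≤ prob p (A ∩ W) := prob_nonneg hp _
  have hT2 : 0 ≤ prob p (A ∩ Wᶜ) := prob_nonneg hp _
  have hT3 : 0 ≤ prob p (Aᶜ ∩ W) := prob_nonneg hp _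
  have hT4 : 0 ≤ prob p (Aᶜ ∩ Wᶜ ∩ Γ) := prob_nonneg hp _
  have hT5 : 0 ≤ prob p (Aᶜ ∩ Wᶜ ∩ Γᶜ) := prob_nonneg hp _
  have hy1K : 0 ≤ prob p (YK ∩ (A ∩ W)) := prob_nonneg hp _
  have hy2W : 0 ≤ prob p (YW ∩ (A ∩ Wᶜ)) := prob_nonneg hp _
  have hy3K : 0 ≤ prob p (YK ∩ (Aᶜ ∩ W)) := prob_nonneg hp _
  have hy4B : 0 ≤ prob p (YB ∩ (Aᶜ ∩ Wᶜ ∩ Γ)) := prob_nonneg hp _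
  have hy4W : 0 ≤ prob p (YW ∩ (Aᶜ ∩ Wᶜ ∩ Γ)) := prob_nonneg hp _
  have hy5B : 0 ≤ prob p (YB ∩ (Aᶜ ∩ Wᶜ ∩ Γᶜ)) := prob_nonneg hp _
  have hy5W : 0 ≤ prob p (YW ∩ (Aᶜ ∩ Wᶜ ∩ Γᶜ)) := prob_nonneg hp _
  have hP1' : 0 ≤ prob p (Aᶜ ∩ Wᶜ ∩ Γᶜ) * prob p (A ∩ W) - prob p (A ∩ Wᶜ) * prob p (Aᶜ ∩ W) := by
    linarith
  have hZw : 0 ≤ prob p (Aᶜ ∩ Wᶜ ∩ Γᶜ) * (prob p (YK ∩ (A ∩ W))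
      - (prob p (YK ∩ (A ∩ W)) + prob p (YK ∩ (Aᶜ ∩ W)) + prob p (YW ∩ (Aᶜ ∩ Wᶜ ∩ Γ))
        + prob p (YW ∩ (A ∩ Wᶜ)) + prob p (YW ∩ (Aᶜ ∩ Wᶜ ∩ Γᶜ))) * prob p (A ∩ W))
      - prob p (A ∩ Wᶜ) * (prob p (YK ∩ (Aᶜ ∩ W))
      - (prob p (YK ∩ (A ∩ W)) + prob p (YK ∩ (Aᶜ ∩ W)) + prob p (YW ∩ (Aᶜ ∩ Wᶜ ∩ Γ))
        + prob p (YW ∩ (A ∩ Wᶜ)) + prob p (YW ∩ (Aᶜ ∩ Wᶜ ∩ Γᶜ))) * prob p (Aᶜ ∩ W)) := by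
    linear_combination hZC
  have hc1 : (prob p (YK ∩ (A ∩ W)) + prob p (YK ∩ (Aᶜ ∩ W)) + prob p (YW ∩ (Aᶜ ∩ Wᶜ ∩ Γ))
        + prob p (YW ∩ (A ∩ Wᶜ)) + prob p (YW ∩ (Aᶜ ∩ Wᶜ ∩ Γᶜ))) * prob p (A ∩ W)
      ≤ prob p (YK ∩ (A ∩ W)) := by
    linear_combination hHarW_1
  have hmix' : prob p (YK ∩ (Aᶜ ∩ W)) + prob p (YW ∩ (Aᶜ ∩ Wᶜ ∩ Γᶜ))
      ≤ (prob p (YK ∩ (A ∩ W)) + prob p (YK ∩ (Aᶜ ∩ W)) + prob p (YW ∩ (Aᶜ ∩ Wᶜ ∩ Γ))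
        + prob p (YW ∩ (A ∩ Wᶜ)) + prob p (YW ∩ (Aᶜ ∩ Wᶜ ∩ Γᶜ))) * (prob p (Aᶜ ∩ W) + prob p (Aᶜ ∩ Wᶜ ∩ Γᶜ)) := by
    linear_combination hmix
  have hw1 := w1_nonneg (prob p (A ∩ W)) (prob p (Aᶜ ∩ W)) (prob p (Aᶜ ∩ Wᶜ ∩ Γ)) (prob p (A ∩ Wᶜ))
    (prob p (Aᶜ ∩ Wᶜ ∩ Γᶜ)) (prob p (YK ∩ (A ∩ W))) (prob p (YK ∩ (Aᶜ ∩ W)))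
    (prob p (YW ∩ (Aᶜ ∩ Wᶜ ∩ Γ))) (prob p (YW ∩ (A ∩ Wᶜ))) (prob p (YW ∩ (Aᶜ ∩ Wᶜ ∩ Γᶜ)))
    hT1 hT3 hT4 hT2 hT5 hy1K hy3K hy4W hy2W hy5W hP1' hZw hc1 hmix'
  have hW1 : 0 ≤ (prob p (Aᶜ ∩ W) + prob p (Aᶜ ∩ Wᶜ ∩ Γ)) * (prob p (YK ∩ (A ∩ W))
      - (prob p (YK ∩ (A ∩ W)) + prob p (YW ∩ (A ∩ Wᶜ)) + prob p (YK ∩ (Aᶜ ∩ W))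
        + prob p (YW ∩ (Aᶜ ∩ Wᶜ ∩ Γ)) + prob p (YW ∩ (Aᶜ ∩ Wᶜ ∩ Γᶜ))) * prob p (A ∩ W))
      - prob p (A ∩ W) * (prob p (YK ∩ (Aᶜ ∩ W))
      - (prob p (YK ∩ (A ∩ W)) + prob p (YW ∩ (A ∩ Wᶜ)) + prob p (YK ∩ (Aᶜ ∩ W))
        + prob p (YW ∩ (Aᶜ ∩ Wᶜ ∩ Γ)) + prob p (YW ∩ (Aᶜ ∩ Wᶜ ∩ Γᶜ))) * prob p (Aᶜ ∩ W))
      + (prob p (YK ∩ (A ∩ W)) + prob p (YW ∩ (A ∩ Wᶜ)) + prob p (YK ∩ (Aᶜ ∩ W))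
        + prob p (YW ∩ (Aᶜ ∩ Wᶜ ∩ Γ)) + prob p (YW ∩ (Aᶜ ∩ Wᶜ ∩ Γᶜ)))
        * (prob p (Aᶜ ∩ Wᶜ ∩ Γᶜ) * prob p (A ∩ W) - prob p (A ∩ Wᶜ) * prob p (Aᶜ ∩ W)) := by
    linear_combination hw1
  have hZC' : 0 ≤ prob p (Aᶜ ∩ Wᶜ ∩ Γᶜ) * (prob p (YK ∩ (A ∩ W))
      - (prob p (YK ∩ (A ∩ W)) + prob p (YW ∩ (A ∩ Wᶜ)) + prob p (YK ∩ (Aᶜ ∩ W))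
        + prob p (YW ∩ (Aᶜ ∩ Wᶜ ∩ Γ)) + prob p (YW ∩ (Aᶜ ∩ Wᶜ ∩ Γᶜ))) * prob p (A ∩ W))
      - prob p (A ∩ Wᶜ) * (prob p (YK ∩ (Aᶜ ∩ W))
      - (prob p (YK ∩ (A ∩ W)) + prob p (YW ∩ (A ∩ Wᶜ)) + prob p (YK ∩ (Aᶜ ∩ W))
        + prob p (YW ∩ (Aᶜ ∩ Wᶜ ∩ Γ)) + prob p (YW ∩ (Aᶜ ∩ Wᶜ ∩ Γᶜ))) * prob p (Aᶜ ∩ W)) := by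
    linear_combination hZC
  -- rewrite the goal into the masses
  rw [PeL, PUeL, PenL, PUenL, PU, PB, PD, PAΓ, PA, PAΓc, PAc, MYBAΓ, MYKA, cW1, MYBAΓc, MYKAc, cW3,
    MYB, MYK, MYW]
  -- the certificate
  have key := zc_rootw_cert (p f₁) (p f₂) (prob p (A ∩ W)) (prob p (A ∩ Wᶜ)) (prob p (Aᶜ ∩ W))
    (prob p (Aᶜ ∩ Wᶜ ∩ Γ)) (prob p (Aᶜ ∩ Wᶜ ∩ Γᶜ))
    (prob p (YK ∩ (A ∩ W))) (prob p (YB ∩ (A ∩ Wᶜ))) (prob p (YK ∩ (A ∩ Wᶜ))) (prob p (YW ∩ (A ∩ Wᶜ)))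
    (prob p (YK ∩ (Aᶜ ∩ W))) (prob p (YB ∩ (Aᶜ ∩ Wᶜ ∩ Γ))) (prob p (YK ∩ (Aᶜ ∩ Wᶜ ∩ Γ)))
    (prob p (YW ∩ (Aᶜ ∩ Wᶜ ∩ Γ))) (prob p (YB ∩ (Aᶜ ∩ Wᶜ ∩ Γᶜ))) (prob p (YK ∩ (Aᶜ ∩ Wᶜ ∩ Γᶜ)))
    (prob p (YW ∩ (Aᶜ ∩ Wᶜ ∩ Γᶜ)))
    hp0 hp1 hq0 hq1 hT1 hT2 hT3 hT4 hT5 hsum.symm hHarB_12 hHarB_124 hHarK_12 hHarK_124 hW1 hZC'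
    hy1K hy2B_y2K hy2B_y2W hy2W hy3K hy4B hy4B_y4K hy4B_y4W hy4W hy5B hy5B_y5W hy5W
  refine le_of_le_of_eq key ?_
  ring

end TheoremFAbstract

end Summit.Ventures.PercRepro2
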